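import Mathlib
import Summits.Ventures.PercRepro2.HCov
import Summits.Ventures.PercRepro2.PendantRoot

/-!
# A ROOT as a leaf at `o`, part 2: the thirteen cells of the pattern of `(o, a₂, a₃, b)`
(blind cell PercRepro2, p4 g2; S3 (G4-o), proofs/subclaims/S3-CLASSES.md §S3.10)

Every mass of `Gc` in either world of the leaf edge is the probability of an event of `G − a₁`
that depends only on the five connections `o ↔ a₂`, `o ↔ a₃`, `a₂ ↔ a₃`, `o ↔ b`, `a₂ ↔ b`
(`stateVec`); by transitivity only thirteen joint states occur (`consistent`).  The identity of
`(G4-o)` is a polynomial identity in the thirteen cell masses `prob (cell v)`; this file proves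
the additivity `prob M = ∑_{v ∈ consistent, φ v} prob (cell v)` for every event `M` whose
membership is a Boolean function `φ` of the state vector (`prob_eq_sum_cells`), and the two
rewriting lemmas `conn_comm_eq`, `connEvent_self` used to match the masses against the cells.
-/

namespace Summit.Ventures.PercRepro2

open UnionCluster CovForm PendantRoot

namespace RootLeafO

variable {V : Type*} {E : Type*} [Fintype E] [DecidableEq E] {R : Type*} [CommRing R]

omit [Fintype E] [DecidableEq E] in
/-- Additivity of `prob` over a pairwise disjoint finite family. -/
lemma prob_biUnion [Fintype E] [DecidableEq E] {ι : Type*} [DecidableEq ι] (p : E → R)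
    (I : Finset ι) (A : ι → Set (Config E))
    (hdisj : ∀ i ∈ I, ∀ j ∈ I, i ≠ j → Disjoint (A i) (A j)) :
    prob p (⋃ i ∈ I, A i) = ∑ i ∈ I, prob p (A i) := by
  classical
  induction I using Finset.induction_on with
  | empty => simp [prob_empty]
  | insert a I ha ih =>
    rw [Finset.set_biUnion_insert, Finset.sum_insert ha, prob_union_of_disjoint, ih]
    · intro i hi j hj hij
      exact hdisj i (Finset.mem_insert_of_mem hi) j (Finset.mem_insert_of_mem hj) hij
    · rw [Set.disjoint_iUnion₂_right]
      intro i hi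
      exact hdisj a (Finset.mem_insert_self a I) i (Finset.mem_insert_of_mem hi)
        (fun h => ha (h ▸ hi))

/-- A state of the five connections `(o↔a₂, o↔a₃, a₂↔a₃, o↔b, a₂↔b)`. -/
abbrev B5 := Bool × Bool × Bool × Bool × Bool

section Cells

variable [Fintype V] [DecidableEq V] (ends : E → Sym2 V) (o a₂ a₃ b : V)

/-- The state vector of a configuration. -/
def stateVec (ω : Config E) : B5 :=
  (decide (Conn ends ω o a₂), decide (Conn ends ω o a₃), decide (Conn ends ω a₂ a₃),
    decide (Conn ends ω o b), decide (Conn ends ω a₂ b))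

/-- The cell of a state: the configurations with that state vector. -/
def cell (v : B5) : Set (Config E) := {ω | stateVec ends o a₂ a₃ b ω = v}

/-- The thirteen consistent states (transitivity among `o, a₂, a₃` and among `o, a₂, b`). -/
def consistent : Finset B5 :=
  {(false, false, false, false, false), (false, false, false, true, false),
    (false, false, false, false, true), (false, true, false, false, false),
    (false, true, false, true, false), (false, true, false, false, true),
    (false, false, true, false, false), (false, false, true, true, false),
    (false, false, true, false, true), (true, false, false, false, false),
    (true, true, true, false, false), (true, false, false, true, true), (true, true, true, true, true)}

omit [DecidableEq E] in
/-- Every configuration has a consistent state. -/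
lemma stateVec_mem_consistent (ω : Config E) : stateVec ends o a₂ a₃ b ω ∈ consistent := by
  have t1 : Conn ends ω o a₂ → Conn ends ω o a₃ → Conn ends ω a₂ a₃ :=
    fun h1 h2 => conn_trans (conn_symm h1) h2
  have t2 : Conn ends ω o a₂ → Conn ends ω a₂ a₃ → Conn ends ω o a₃ := fun h1 h2 => conn_trans h1 h2
  have t3 : Conn ends ω o a₃ → Conn ends ω a₂ a₃ → Conn ends ω o a₂ :=
    fun h1 h2 => conn_trans h1 (conn_symm h2)
  have t4 : Conn ends ω o a₂ → Conn ends ω o b → Conn ends ω a₂ b :=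
    fun h1 h2 => conn_trans (conn_symm h1) h2
  have t5 : Conn ends ω o a₂ → Conn ends ω a₂ b → Conn ends ω o b := fun h1 h2 => conn_trans h1 h2
  have t6 : Conn ends ω o b → Conn ends ω a₂ b → Conn ends ω o a₂ :=
    fun h1 h2 => conn_trans h1 (conn_symm h2)
  simp only [stateVec, consistent, Finset.mem_insert, Finset.mem_singleton, Prod.mk.injEq]
  by_cases c1 : Conn ends ω o a₂ <;> by_cases c2 : Conn ends ω o a₃ <;>
    by_cases c3 : Conn ends ω a₂ a₃ <;> by_cases c4 : Conn ends ω o b <;>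
    by_cases c5 : Conn ends ω a₂ b <;> simp_all

omit [DecidableEq E] in
/-- Distinct cells are disjoint. -/
lemma disjoint_cell {v w : B5} (hvw : v ≠ w) :
    Disjoint (cell ends o a₂ a₃ b v) (cell ends o a₂ a₃ b w) := by
  rw [Set.disjoint_left]
  intro ω hv hw
  exact hvw (hv.symm.trans hw)

variable (p : E → R)

/-- **Cell decomposition**: an event whose membership is a Boolean function `φ` of the state
vector has probability the sum of its consistent cells. -/
theorem prob_eq_sum_cells (M : Set (Config E)) (φ : B5 → Bool)
    (hM : ∀ ω, ω ∈ M ↔ φ (stateVec ends o a₂ a₃ b ω) = true) :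
    prob p M = ∑ v ∈ consistent.filter (fun v => φ v = true), prob p (cell ends o a₂ a₃ b v) := by
  have hMeq : M = ⋃ v ∈ consistent.filter (fun v => φ v = true), cell ends o a₂ a₃ b v := by
    ext ω
    simp only [Set.mem_iUnion, Finset.mem_filter, exists_prop, cell, Set.mem_setOf_eq]
    constructor
    · intro h
      exact ⟨_, ⟨stateVec_mem_consistent ends o a₂ a₃ b ω, (hM ω).1 h⟩, rfl⟩
    · rintro ⟨v, ⟨_, hφ⟩, hv⟩
      exact (hM ω).2 (hv ▸ hφ)
  rw [hMeq, prob_biUnion]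
  intro v _ w _ hvw
  exact disjoint_cell ends o a₂ a₃ b hvw

end Cells


section Rewriting

variable (ends : E → Sym2 V)

omit [Fintype E] [DecidableEq E] in
/-- Connection is symmetric (as an equation of propositions, for directed rewriting). -/
lemma conn_comm_eq (ω : Config E) (u v : V) : Conn ends ω u v = Conn ends ω v u :=
  propext ⟨conn_symm, conn_symm⟩

omit [Fintype E] [DecidableEq E] in
/-- `{u ↔ u}` is sure. -/
lemma connEvent_self (u : V) : connEvent ends u u = Set.univ := by
  ext ω
  simp only [mem_connEvent, Set.mem_univ, iff_true]
  exact conn_refl ends ω u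

end Rewriting

end RootLeafO

end Summit.Ventures.PercRepro2
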